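import Mathlib

/-!
# Positive-semidefinite rank of the correlation polytope (Lee–Raghavendra–Steurer 2015)

The **correlation polytope** (Boolean quadric polytope) is `CORR_n = conv{x xᵀ : x ∈ {0,1}ⁿ} ⊆ ℝ^{n×n}`.
Its **psd rank** `rk_psd(CORR_n)` is the least `m` such that `CORR_n` is a linear image of an affine
slice of the cone `𝕊^m_+` (a "psd lift" / lifted-LMI description of size `m`); by the factorisation
theorem of Fiorini–Massar–Pokutta–Tiwary–de Wolf and Gouveia–Parrilo–Thomas (LRS Prop. 1.10) this is
the psd rank of any slack matrix of `CORR_n`, i.e. the least `m` such that the slack matrix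
`S[(c,b), x] = b − ⟨c, x xᵀ⟩` (valid linear inequalities `⟨c, ·⟩ ≤ b` versus vertices `x xᵀ`) factors
as `S[(c,b), x] = tr(U_{(c,b)} V_x)` with `U, V ∈ 𝕊^m_+`.

* `LeeRaghavendraSteurer2015_thm11` — NAMED FACT (not proved here): `rk_psd(CORR_n) ≥ 2^{α n^{2/13}}`
  for an absolute `α > 0` and all `n ≥ 1` (LRS Theorem 1.1 = Theorem 5.4), stated as: for
  `m < 2^{α n^{2/13}}` the full slack matrix of `CORR_n` (ALL valid inequalities × all `2ⁿ` vertices)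
  has no positive-semidefinite factorisation of size `m`.  This form is implied by the printed theorem
  and Prop. 1.10 (a size-`m` factorisation of the full slack matrix restricts to one of every finite
  slack matrix, hence gives a psd lift of size `m`).  It is the first (and essentially only)
  super-polynomial lower bound on semidefinite extension complexity of an explicit polytope; via
  De Simone / FMPTW it transfers to `CUT_n`, `TSP_n`, `STAB_n` (LRS Cor. 1.2).  The proof (sum-of-squares
  degree of Grigoriev's knapsack tautologies ⇒ psd rank of pattern matrices, LRS Thm 3.8, via quantum
  entropy / low-degree matrix approximation) is far beyond this file.

The psd factorisation is inlined (no `psdRank` definition) in the shape used by the `PermanentalCones`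
route of `ValiantsHypothesis` (`Summit.ValiantsHypothesis.….Theses.PermanentalCones.PermanentalConeHard`
and its core stub), whose only known lower-bound engine this is.

References: J. R. Lee, P. Raghavendra, D. Steurer, *Lower bounds on the size of semidefinite
programming relaxations*, STOC 2015, arXiv:1411.6317, Thm 1.1 p. 4, Prop. 1.10 p. 7, Thm 5.4 p. 23
[LeeRaghavendraSteurer2015]; J. Gouveia, P. Parrilo, R. Thomas, *Lifts of convex sets and cone
factorizations*, Math. Oper. Res. 38 (2013) [GouveiaParriloThomas2013].
-/

namespace Literature.Combinatorics.Optimization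

/-- **Lee–Raghavendra–Steurer 2015, Theorem 1.1 (= Theorem 5.4)** (arXiv:1411.6317 p. 4 / p. 23,
verbatim): "For every `n ≥ 1`, we have `rk_psd(CORR_n) ≥ 2^{Ω(n^{2/13})}`" / "There is a constant
`α > 0` such that for every `n ≥ 1`, `rk_psd(CORR_n) ≥ 2^{α n^{2/13}}`."  Dictionary: `CORR_n =
conv{x xᵀ : x ∈ {0,1}ⁿ}` (§1.1); `rk_psd(P)` = least size of a psd lift of `P` = psd rank of any slack
matrix of `P` (Def. 1.7, Prop. 1.10); a rank-`m` psd factorisation of a nonnegative matrix `M` is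
`M_{ij} = tr(A_i B_j)` with `A_i, B_j ∈ 𝕊^m_+` (Def. 1.7).  Stated here for the FULL slack matrix —
rows = all valid linear inequalities `Σ_{ij} c_{ij} x_i x_j ≤ b` on `{0,1}ⁿ` (equivalently on
`CORR_n`), columns = all vertices `x ∈ {0,1}ⁿ` — which contains every slack matrix of `CORR_n` as a
submatrix, so the printed bound implies: no psd factorisation of size `m < 2^{α n^{2/13}}`.
[cite: LeeRaghavendraSteurer2015, Theorem 1.1] -/
def LeeRaghavendraSteurer2015_thm11 : Prop :=
  ∃ α : ℝ, 0 < α ∧ ∀ n : ℕ, 1 ≤ n → ∀ m : ℕ,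
    (m : ℝ) < (2 : ℝ) ^ (α * (n : ℝ) ^ ((2 : ℝ) / 13)) →
    ¬ ∃ (U : {cb : Matrix (Fin n) (Fin n) ℝ × ℝ //
              ∀ x : Fin n → ℝ, (∀ i, x i = 0 ∨ x i = 1) →
                ∑ i, ∑ j, cb.1 i j * (x i * x j) ≤ cb.2} → Matrix (Fin m) (Fin m) ℝ)
        (V : {x : Fin n → ℝ // ∀ i, x i = 0 ∨ x i = 1} → Matrix (Fin m) (Fin m) ℝ),
        (∀ cb, (U cb).PosSemidef) ∧ (∀ x, (V x).PosSemidef) ∧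
        ∀ cb x, cb.1.2 - ∑ i, ∑ j, cb.1.1 i j * (x.1 i * x.1 j) = Matrix.trace (U cb * V x)

end Literature.Combinatorics.Optimization
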